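import Summits.Ventures.GridStability.Models.SwingTubeLegs

/-!
# SwingTubeChain — the GENERIC n-machine kernel tube integrator, part 3: the CHAIN theorem and sign-free SLICE BOXES

Venture GRIDFUSION (LADDER-GRIDFUSION G1-cct / G2 next-wave lever; seat gridfusion-model-1 g6).  §1 `holds_next` (restart box at the end of
a leg), `le_startAt`, `chain_sound` (induction along the list: `chainOK d K legs`, `Y a ∈ K.toSet`, `T` inside leg `k` ⇒ the box
`kboxAt K legs k` holds at `start_k` and the re-based tube of leg `k` holds on `[start_k, T]`), packaged as `tube_of_chainOK` for any initial
box `K` at `t = 0` (`Y 0 ∈ K.toSet ((Y 0).1 0)` — a hypothesis the instance discharges from its pre-fault data).  §2 SLICE BOXES for the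
«K ⊂ S» consumer, SIGN-FREE (machine `i` may swing faster or slower than the reference machine `0`): for `T − start ∈ [sa, sb]` the relative
angle `δ_i(T) − δ₀(T)` lies in `[(qlo_i − qhi₀) + min(β sa, β sb) + min(γ sa², γ sb²)/2, …]` with `β = wlo_i − whi₀`, `γ = L_i − H₀` (and the
mirrored upper data), the speeds in `[wlo_j + min(L_j sa, L_j sb), whi_j + max(H_j sa, H_j sb)]` (`Leg.sliceBox`, test `Leg.sliceOK` =
`0 ≤ sa ≤ sb ≤ τ` only); `mem_sliceBox`; `clearingState_of_chainOK`.  Instances: `WSCC9FaultOnTubeGeneric36` (the bus-7 fault re-derived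
through this generic path).  THREE COLUMNS: CERTIFIED = tube/hull sentences for the MODEL `d.toModel`; nothing VALIDATED; no stability claim.
[cite: Moore1979, §8.1 eqs. (8.5), (8.10) and the step-by-step continuation after (8.5)]
-/

noncomputable section

open Real Set Finset

namespace Summit.Ventures.GridStability.Models

namespace SwingTube

variable {n : ℕ}

/-! ### §1 The chain -/

/-- **Restart box at the end of a leg.** Under the hypotheses of `leg_step` with the full step inside the horizon (`a + τ ≤ T`),
the box `g.next K` holds at `a + τ`. -/
theorem holds_next [NeZero n] {g : Leg n} {d : SwingQ n} {K : KBox n} (hf : g.fieldOK d = true) (hi : g.inclOK K = true)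
    {a T : ℝ} (ha : 0 ≤ a) (haT : a + (g.τ : ℝ) ≤ T) {Y : ℝ → ClassicalSwing.State n}
    (hY : d.toModel.IsSolutionOn Y (Icc 0 T)) (hK : Y a ∈ K.toSet ((Y 0).1 0)) :
    Y (a + (g.τ : ℝ)) ∈ (g.next K).toSet ((Y 0).1 0) := by
  have hτ : (0 : ℝ) < (g.τ : ℝ) := by
    simp only [Leg.inclOK, Bool.and_eq_true, decide_eq_true_eq] at hi
    exact_mod_cast hi.1
  have hY' : d.toModel.IsSolutionOn Y (Icc 0 (a + (g.τ : ℝ))) := fun t ht =>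
    (hY t ⟨ht.1, ht.2.trans haT⟩).mono (Icc_subset_Icc_right haT)
  have h := leg_step hf hi ha (by linarith) (by linarith) hY' hK (a + (g.τ : ℝ)) ⟨by linarith, le_rfl⟩
  rw [Leg.mem_tubeSet] at h
  rw [KBox.mem_toSet] at hK ⊢
  intro i
  obtain ⟨k1, k2, k3, k4⟩ := hK i
  obtain ⟨t1, t2, t3, t4⟩ := h i
  simp only [add_sub_cancel_left] at t1 t2 t3 t4
  have p1 := mul_le_mul_of_nonneg_right k3 hτ.le
  have p2 := mul_le_mul_of_nonneg_right k4 hτ.le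
  simp only [Leg.next]
  push_cast
  refine ⟨by linarith, by linarith, by linarith, by linarith⟩

/-- Start times do not decrease along a checked chain (every leg has `τ > 0`). -/
theorem le_startAt (d : SwingQ n) :
    ∀ (gs : List (Leg n)) (K : KBox n) (a : ℚ) (k : ℕ), chainOK d K gs = true → a ≤ startAt a gs k
  | [], _, _, 0, _ => le_rfl
  | [], _, _, _ + 1, _ => le_rfl
  | _ :: _, _, _, 0, _ => le_rfl
  | g :: gs, K, a, k + 1, hc => by
    simp only [chainOK, Bool.and_eq_true] at hc
    obtain ⟨⟨_, hi⟩, hc'⟩ := hc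
    have hτ : 0 < g.τ := by
      simp only [Leg.inclOK, Bool.and_eq_true, decide_eq_true_eq] at hi
      exact hi.1
    have ih := le_startAt d gs (g.next K) (a + g.τ) k hc'
    simp only [startAt]
    linarith

/-- **CHAIN SOUNDNESS.** `chainOK d K legs`, `Y a ∈ K.toSet` with `a ≥ 0`, a solution of `d.toModel` on `[0, T]` with `T` inside leg `k`
⇒ the box `kboxAt K legs k` holds at `start_k` and the tube of leg `k` holds on `[start_k, T]`. -/
theorem chain_sound [NeZero n] (d : SwingQ n) : ∀ (legs : List (Leg n)) (K : KBox n) (a : ℚ), 0 ≤ a → chainOK d K legs = true →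
    ∀ (k : ℕ) (g : Leg n), legs[k]? = some g → ∀ (T : ℝ) (Y : ℝ → ClassicalSwing.State n),
      d.toModel.IsSolutionOn Y (Icc 0 T) → Y (a : ℝ) ∈ K.toSet ((Y 0).1 0) →
      ((startAt a legs k : ℚ) : ℝ) ≤ T → T - ((startAt a legs k : ℚ) : ℝ) ≤ (g.τ : ℝ) →
      Y ((startAt a legs k : ℚ) : ℝ) ∈ (kboxAt K legs k).toSet ((Y 0).1 0) ∧
        ∀ t ∈ Icc ((startAt a legs k : ℚ) : ℝ) T,
          Y t ∈ g.tubeSet (Y ((startAt a legs k : ℚ) : ℝ)) (t - ((startAt a legs k : ℚ) : ℝ))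
  | [], _, _, _, _, k, g, hk => by simp at hk
  | g₀ :: gs, K, a, ha, hc, 0, g, hk => by
    intro T Y hY hK h1 h2
    simp only [List.getElem?_cons_zero, Option.some.injEq] at hk
    subst hk
    simp only [chainOK, Bool.and_eq_true] at hc
    obtain ⟨⟨hf, hi⟩, -⟩ := hc
    simp only [kboxAt, startAt] at h1 h2 ⊢
    exact ⟨hK, leg_step hf hi (by exact_mod_cast ha) h1 h2 hY hK⟩
  | g₀ :: gs, K, a, ha, hc, k + 1, g, hk => by
    intro T Y hY hK h1 h2
    simp only [List.getElem?_cons_succ] at hk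
    simp only [chainOK, Bool.and_eq_true] at hc
    obtain ⟨⟨hf, hi⟩, hc'⟩ := hc
    simp only [kboxAt, startAt] at h1 h2 ⊢
    have hτ : 0 < g₀.τ := by
      simp only [Leg.inclOK, Bool.and_eq_true, decide_eq_true_eq] at hi
      exact hi.1
    have ha' : 0 ≤ a + g₀.τ := by linarith
    have hle : a + g₀.τ ≤ startAt (a + g₀.τ) gs k := le_startAt d gs (g₀.next K) (a + g₀.τ) k hc'
    have hle' : (((a + g₀.τ : ℚ)) : ℝ) ≤ T := le_trans (by exact_mod_cast hle) h1
    have hK' : Y (((a + g₀.τ : ℚ)) : ℝ) ∈ (g₀.next K).toSet ((Y 0).1 0) := by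
      push_cast
      exact holds_next hf hi (by exact_mod_cast ha) (by push_cast at hle'; exact hle') hY hK
    exact chain_sound d gs (g₀.next K) (a + g₀.τ) ha' hc' k g hk T Y hY hK' h1 h2

/-- SHARDING: the chain check of a concatenation splits at the junction box `kboxAt K l₁ |l₁|` (so a long chain can be decided in
several files, each shard one `decide`, the junction box spelled out as a literal via `KBox.eq_of_forall`). -/
theorem chainOK_append (d : SwingQ n) : ∀ (l₁ l₂ : List (Leg n)) (K : KBox n),
    chainOK d K (l₁ ++ l₂) = (chainOK d K l₁ && chainOK d (kboxAt K l₁ l₁.length) l₂)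
  | [], l₂, K => by simp [chainOK, kboxAt]
  | g :: gs, l₂, K => by
    simp only [List.cons_append, chainOK, List.length_cons, kboxAt, chainOK_append d gs l₂ (g.next K), Bool.and_assoc]

/-- The K-box of a concatenated chain past the first part is the K-box of the second part from the junction box. -/
theorem kboxAt_append : ∀ (l₁ l₂ : List (Leg n)) (K : KBox n) (k : ℕ),
    kboxAt K (l₁ ++ l₂) (l₁.length + k) = kboxAt (kboxAt K l₁ l₁.length) l₂ k
  | [], l₂, K, k => by simp [kboxAt]
  | g :: gs, l₂, K, k => by
    simp only [List.cons_append, List.length_cons, kboxAt]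
    rw [show gs.length + 1 + k = (gs.length + k) + 1 by ring]
    simp only [kboxAt]
    exact kboxAt_append gs l₂ (g.next K) k

/-- `legAt` agrees with list indexing inside the list. -/
theorem getElem?_eq_legAt {legs : List (Leg n)} {k : ℕ} (hk : k < legs.length) : legs[k]? = some (legAt legs k) := by
  simp only [legAt, List.getD_eq_getElem?_getD, List.getElem?_eq_getElem hk, Option.getD_some]

/-- **THE TUBE OF A CHECKED CHAIN.** `chainOK d K legs`, `Y 0 ∈ K.toSet (δ₀(0))` (the initial box), `k < |legs|`, a time `T` inside leg
`k`, a solution `Y` of `d.toModel` on `[0, T]` ⇒ the box `kboxAt K legs k` holds at `start_k` and the tube of leg `k` holds on `[start_k, T]`.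
[cite: Moore1979, §8.1 (step-by-step continuation after (8.5)), eq. (8.10)] -/
theorem tube_of_chainOK [NeZero n] {d : SwingQ n} {K : KBox n} {legs : List (Leg n)} (hc : chainOK d K legs = true)
    {k : ℕ} (hk : k < legs.length) {T : ℝ} (hT1 : ((startAt 0 legs k : ℚ) : ℝ) ≤ T)
    (hT2 : T - ((startAt 0 legs k : ℚ) : ℝ) ≤ ((legAt legs k).τ : ℝ))
    {Y : ℝ → ClassicalSwing.State n} (hY : d.toModel.IsSolutionOn Y (Icc 0 T)) (h0 : Y 0 ∈ K.toSet ((Y 0).1 0)) :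
    Y ((startAt 0 legs k : ℚ) : ℝ) ∈ (kboxAt K legs k).toSet ((Y 0).1 0) ∧
      ∀ t ∈ Icc ((startAt 0 legs k : ℚ) : ℝ) T,
        Y t ∈ (legAt legs k).tubeSet (Y ((startAt 0 legs k : ℚ) : ℝ)) (t - ((startAt 0 legs k : ℚ) : ℝ)) := by
  have h0' : Y ((0 : ℚ) : ℝ) ∈ K.toSet ((Y 0).1 0) := by push_cast; exact h0
  exact chain_sound d legs K 0 le_rfl hc k (legAt legs k) (getElem?_eq_legAt hk) T Y hY h0' hT1 hT2

/-! ### §2 Sign-free slice boxes for the «K ⊂ S» consumer -/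

/-- A box for the state at a clearing time: relative angles `a_i = δ_i − δ₀` (machine `0` the reference; `i = 0` trivial) and speeds. -/
structure SliceBox (n : ℕ) where
  /-- relative angles, lower -/
  alo : Fin n → ℚ
  /-- relative angles, upper -/
  ahi : Fin n → ℚ
  /-- speeds, lower -/
  wlo : Fin n → ℚ
  /-- speeds, upper -/
  whi : Fin n → ℚ

/-- Two slice boxes with the same corners are equal. -/
theorem SliceBox.eq_of_forall {S S' : SliceBox n}
    (h : ∀ i, S.alo i = S'.alo i ∧ S.ahi i = S'.ahi i ∧ S.wlo i = S'.wlo i ∧ S.whi i = S'.whi i) : S = S' := by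
  obtain ⟨a, b, c, e⟩ := S
  obtain ⟨a', b', c', e'⟩ := S'
  simp only [SliceBox.mk.injEq]
  exact ⟨funext fun i => (h i).1, funext fun i => (h i).2.1, funext fun i => (h i).2.2.1, funext fun i => (h i).2.2.2⟩

/-- The slice box as a SET of states. -/
def SliceBox.toSet [NeZero n] (S : SliceBox n) : Set (ClassicalSwing.State n) :=
  {x | ∀ i, (S.alo i : ℝ) ≤ x.1 i - x.1 0 ∧ x.1 i - x.1 0 ≤ (S.ahi i : ℝ) ∧ (S.wlo i : ℝ) ≤ x.2 i ∧ x.2 i ≤ (S.whi i : ℝ)}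

/-- Unfolding `SliceBox.toSet` membership. -/
theorem SliceBox.mem_toSet [NeZero n] (S : SliceBox n) (x : ClassicalSwing.State n) :
    x ∈ S.toSet ↔ ∀ i, (S.alo i : ℝ) ≤ x.1 i - x.1 0 ∧ x.1 i - x.1 0 ≤ (S.ahi i : ℝ) ∧
      (S.wlo i : ℝ) ≤ x.2 i ∧ x.2 i ≤ (S.whi i : ℝ) :=
  Iff.rfl

namespace Leg

variable [NeZero n]

/-- The SIGN-FREE SLICE BOX of leg `g` started from `K`, offsets `s ∈ [sa, sb]`. -/
def sliceBox (g : Leg n) (K : KBox n) (sa sb : ℚ) : SliceBox n where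
  alo i := (K.qlo i - K.qhi 0) + min ((K.wlo i - K.whi 0) * sa) ((K.wlo i - K.whi 0) * sb) +
    min ((g.L i - g.H 0) * sa ^ 2) ((g.L i - g.H 0) * sb ^ 2) / 2
  ahi i := (K.qhi i - K.qlo 0) + max ((K.whi i - K.wlo 0) * sa) ((K.whi i - K.wlo 0) * sb) +
    max ((g.H i - g.L 0) * sa ^ 2) ((g.H i - g.L 0) * sb ^ 2) / 2
  wlo j := K.wlo j + min (g.L j * sa) (g.L j * sb)
  whi j := K.whi j + max (g.H j * sa) (g.H j * sb)

/-- Admissible slice: `0 ≤ sa ≤ sb ≤ τ`. -/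
def sliceOK (g : Leg n) (sa sb : ℚ) : Bool :=
  decide (0 ≤ sa) && decide (sa ≤ sb) && decide (sb ≤ g.τ)

end Leg

/-- **Slice membership.** `g.sliceOK sa sb`, `Y a ∈ K.toSet`, the tube of `g` re-based at `a` holds at `T`, `T − a ∈ [sa, sb]` ⇒ `Y T`
lies in the sign-free slice box. [folklore] -/
theorem mem_sliceBox [NeZero n] {g : Leg n} {K : KBox n} {sa sb : ℚ} (h : g.sliceOK sa sb = true) {a T : ℝ}
    {Y : ℝ → ClassicalSwing.State n} (hK : Y a ∈ K.toSet ((Y 0).1 0)) (ht : Y T ∈ g.tubeSet (Y a) (T - a))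
    (hsa : (sa : ℝ) ≤ T - a) (hsb : T - a ≤ (sb : ℝ)) : Y T ∈ (g.sliceBox K sa sb).toSet := by
  simp only [Leg.sliceOK, Bool.and_eq_true, decide_eq_true_eq] at h
  obtain ⟨⟨hsa0, -⟩, -⟩ := h
  rw [KBox.mem_toSet] at hK
  rw [Leg.mem_tubeSet] at ht
  rw [SliceBox.mem_toSet]
  have hsa0' : (0 : ℝ) ≤ (sa : ℝ) := by exact_mod_cast hsa0
  have hs0 : 0 ≤ T - a := le_trans hsa0' hsa
  have hqa : ((sa : ℝ)) ^ 2 ≤ (T - a) ^ 2 := pow_le_pow_left₀ hsa0' hsa 2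
  have hqb : (T - a) ^ 2 ≤ ((sb : ℝ)) ^ 2 := pow_le_pow_left₀ hs0 hsb 2
  obtain ⟨q0l, q0u, w0l, w0u⟩ := hK 0
  obtain ⟨-, -, p0l, p0u⟩ := ht 0
  intro i
  obtain ⟨qil, qiu, wil, wiu⟩ := hK i
  obtain ⟨til, tiu, pil, piu⟩ := ht i
  -- linear-in-s and quadratic-in-s pieces, sign-free via `mul_mem_minmax`
  have b1 := mul_mem_minmax ((K.wlo i : ℝ) - (K.whi 0 : ℝ)) hsa hsb
  have b2 := mul_mem_minmax ((K.whi i : ℝ) - (K.wlo 0 : ℝ)) hsa hsb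
  have b3 := mul_mem_minmax ((g.L i : ℝ) - (g.H 0 : ℝ)) hqa hqb
  have b4 := mul_mem_minmax ((g.H i : ℝ) - (g.L 0 : ℝ)) hqa hqb
  have b5 := mul_mem_minmax (g.L i : ℝ) hsa hsb
  have b6 := mul_mem_minmax (g.H i : ℝ) hsa hsb
  -- the actual speed differences at a, times (T − a) ≥ 0
  have d1 : ((K.wlo i : ℝ) - (K.whi 0 : ℝ)) * (T - a) ≤ ((Y a).2 i - (Y a).2 0) * (T - a) :=
    mul_le_mul_of_nonneg_right (by linarith) hs0
  have d2 : ((Y a).2 i - (Y a).2 0) * (T - a) ≤ ((K.whi i : ℝ) - (K.wlo 0 : ℝ)) * (T - a) :=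
    mul_le_mul_of_nonneg_right (by linarith) hs0
  simp only [Leg.sliceBox]
  push_cast
  refine ⟨?_, ?_, ?_, ?_⟩
  · linarith [b1.1, b3.1, d1, qil, q0u, pil, p0u]
  · linarith [b2.2, b4.2, d2, qiu, q0l, piu, p0l]
  · linarith [b5.1, wil, til]
  · linarith [b6.2, wiu, tiu]

/-- **THE STATE AT A CLEARING TIME lies in the slice box.** `chainOK d K legs`, initial box `K` at `0`, `k < |legs|`, admissible slice
`(sa, sb)` of leg `k`, `T − start_k ∈ [sa, sb]`, a solution `Y` of `d.toModel` on `[0, T]` ⇒ `Y T ∈ (legAt legs k).sliceBox (kboxAt K legs k) sa sb`.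
[cite: Moore1979, §8.1 eq. (8.10)] -/
theorem clearingState_of_chainOK [NeZero n] {d : SwingQ n} {K : KBox n} {legs : List (Leg n)} (hc : chainOK d K legs = true)
    {k : ℕ} (hk : k < legs.length) {sa sb : ℚ} (hs : (legAt legs k).sliceOK sa sb = true)
    {T : ℝ} (hT1 : ((startAt 0 legs k : ℚ) : ℝ) + sa ≤ T) (hT2 : T ≤ ((startAt 0 legs k : ℚ) : ℝ) + sb)
    {Y : ℝ → ClassicalSwing.State n} (hY : d.toModel.IsSolutionOn Y (Icc 0 T)) (h0 : Y 0 ∈ K.toSet ((Y 0).1 0)) :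
    Y T ∈ ((legAt legs k).sliceBox (kboxAt K legs k) sa sb).toSet := by
  have hs' := hs
  simp only [Leg.sliceOK, Bool.and_eq_true, decide_eq_true_eq] at hs'
  obtain ⟨⟨hsa0, -⟩, hsbτ⟩ := hs'
  have hsa0' : (0 : ℝ) ≤ (sa : ℝ) := by exact_mod_cast hsa0
  have hsbτ' : ((sb : ℚ) : ℝ) ≤ ((legAt legs k).τ : ℝ) := by exact_mod_cast hsbτ
  have hT1' : ((startAt 0 legs k : ℚ) : ℝ) ≤ T := by linarith
  have hT2' : T - ((startAt 0 legs k : ℚ) : ℝ) ≤ ((legAt legs k).τ : ℝ) := by linarith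
  obtain ⟨hK, htube⟩ := tube_of_chainOK hc hk hT1' hT2' hY h0
  exact mem_sliceBox hs hK (htube T ⟨hT1', le_rfl⟩) (by linarith) (by linarith)

end SwingTube

end Summit.Ventures.GridStability.Models

end
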